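import Summits.CriticalPhenomena.PercolationContinuityZ3.Theorems.PercNearOneGluingNoHeavyConstsConditionedMarker
import Summits.CriticalPhenomena.PercolationContinuityZ3.Theorems.PercNearOneGluingNoHeavyConstsMDLXJointImpliesMDLX
import Summits.CriticalPhenomena.PercolationContinuityZ3.Theorems.PercNearOneGluingNoHeavyConstsMDLXJointMarker
import HarnessLib

/-!
# MDL(X)′ by total covariance along the marker event: it holds whenever `F` and `{s↔z}` are not negatively correlated GIVEN `{s↔y}`
# (PAPER-2 track (ii): constants of the CSH family; seat `prim-consts-2`, gen 17)

builds on p205010 (kernel theorem, internal audit signed; external expert review pending).  Support file (`--supports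
stmt-CriticalPhenomena-4575`); memo `run/shared/lean/prim/consts/FROM-prim-consts-2-g17-CYLINDER-DUALITY.md` §7.  No definitions, no named facts,
no sorries; standard axioms.

Notation (as in `…ConstsMDLXJoint.lean`): owner `s`, avoided set `X`, markers `y`, `z`; `D = {s ↮ X}`, `T = {y ↮ {s}∪X} ∩ D`, `W = {y ↔ z}`,
`Y = {s ↔ y}`, `N = Yᶜ`, `Z = {s ↔ z}`, `ν = μ(·|D)`, `p' = μ(T∩W)/μ(T)`, `σ := ν(Z|Y) − ν(Z|N) − p'` (the slack of the marker corner
`Consts.mdlxJoint_connIndicator`, `σ ≥ 0`).  For a functional `F` of `C_s`: `MDLX(F) := Cov_ν(F, 1_Z) − p'·Cov_ν(F, 1_Y)`.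

* `Consts.mdlx_totalCov_identity` — **THE TOTAL-COVARIANCE SPLIT ALONG `σ(Y)` (ring identity):**
  `MDLX(F) = ν(Y)·Cov_ν(F, 1_Z | Y) + ν(N)·Cov_ν(F, 1_Z | N) + σ·Cov_ν(F, 1_Y)`,
  in the denominator-free form `M·μ(D∩Y)·μ(D∩N) = μ(T)μ(D)·[μ(D∩N)·C_Y + μ(D∩Y)·C_N] + Σ·C_{FY}` with
  `M = μ(T)[μ(D)∫_{D∩Z}F − (∫_D F)μ(D∩Z)] − μ(T∩W)[μ(D)∫_{D∩Y}F − (∫_D F)μ(D∩Y)]` (the `Consts.MDLXJoint` margin),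
  `C_Y = μ(D∩Y)∫_{D∩Y∩Z}F − (∫_{D∩Y}F)μ(D∩Y∩Z)`, `C_N = μ(D∩N)∫_{D∩N∩Z}F − (∫_{D∩N}F)μ(D∩N∩Z)`, `C_{FY} = μ(D)∫_{D∩Y}F − (∫_D F)μ(D∩Y)`,
  `Σ = μ(T)μ(D∩N)μ(D∩Y∩Z) − μ(T)μ(D∩Y)μ(D∩N∩Z) − μ(T∩W)μ(D∩Y)μ(D∩N)`.
* `Consts.mdlxJoint_of_condCov_nonneg` — **THEOREM: the `Consts.MDLXJoint` inequality holds, in every finite weighted graph, at every monotone `F` with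
  `C_Y ≥ 0`, i.e. `Cov(F(C_s), 1{s↔z} | s↔y, s↮X) ≥ 0`** ("no explaining-away given the marker").  The other two terms are theorems of the tree:
  `C_N ≥ 0` is `Consts.markerPA_ge` (BHK Thm 1.3 for `s` repelled from `X∪{y}`), `Σ ≥ 0` is the marker corner `Consts.mdlxJoint_connIndicator`, and
  `C_{FY} ≥ 0` is BHK Thm 1.3 (`Consts.covD_conn_nonneg`).  In the exact census (engines `prim-consts-2/g17/engines/totcov.py`, all up-sets, n = 5, 6) the
  hypothesis `C_Y ≥ 0` holds for ≈ 94–97 % of all up-events — the largest single proved class; the residual class (the up-event LOWERS `P(s↔z)` given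
  `s↔y`: "explaining away given the marker") is where `Consts.MDLXJoint` remains open, and there the identity says exactly how much the two positive
  terms must pay: `ν(Y)·|Cov_ν(F,1_Z|Y)| ≤ ν(N)·Cov_ν(F,1_Z|N) + σ·Cov_ν(F,1_Y)`.
[cite: VandenbergHaggstromKahn2005, Thm. 1.3 (p. 6), Thm. 1.4 (p. 7) with Remark 1 after Thm. 1.2 (p. 5)]
-/

noncomputable section

namespace Summit.CriticalPhenomena.PercolationContinuityZ3.Theorems

open MeasureTheory Set Literature.Probability.LatticeModels Literature.Probability.Percolation
open scoped Classical

namespace Consts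

variable {V : Type*} [Fintype V]

omit [Fintype V] in
/-- **The total-covariance split of the MDL(X)′ margin along the marker event** (pure ring identity in the ten masses/integrals;
`m = mY + mN`, `I = IY + IN`, `mZ = mYZ + mNZ`, `IZ = IYZ + INZ`). [folklore] -/
theorem mdlx_totalCov_identity (t tw mY mN mYZ mNZ IY IN IYZ INZ : ℝ) :
    (t * ((mY + mN) * (IYZ + INZ) - (IY + IN) * (mYZ + mNZ)) - tw * ((mY + mN) * IY - (IY + IN) * mY)) * mY * mN =
      t * (mY + mN) * (mN * (mY * IYZ - IY * mYZ) + mY * (mN * INZ - IN * mNZ)) +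
        (t * mN * mYZ - t * mY * mNZ - tw * mY * mN) * ((mY + mN) * IY - (IY + IN) * mY) := by
  ring

/-- **MDL(X)′ WHENEVER `F` AND `{s↔z}` ARE NONNEGATIVELY CORRELATED GIVEN `{s↔y}`.**  For all weights, owner `s`, avoided set `X`, markers `y`,
`z`, and every monotone functional `F` of the open edge cluster of `s` with
`(∫_{D∩Y} F)·μ(D∩Y∩Z) ≤ μ(D∩Y)·∫_{D∩Y∩Z} F` (`D = {s↮X}`, `Y = {s↔y}`, `Z = {s↔z}`), the `Consts.MDLXJoint` inequality holds:
`μ(T∩W)·[μ(D)∫_{D∩Y}F − (∫_D F)μ(D∩Y)] ≤ μ(T)·[μ(D)∫_{D∩Z}F − (∫_D F)μ(D∩Z)]`.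
[cite: VandenbergHaggstromKahn2005, Thm. 1.3 (p. 6), Thm. 1.4 (p. 7) with Remark 1 after Thm. 1.2 (p. 5)] -/
theorem mdlxJoint_of_condCov_nonneg (w : Sym2 V → unitInterval) (s y z : V) (X : Set V)
    (F : Set (Sym2 V) → ℝ) (hF : Monotone F)
    (hC : (∫ ω in {ω : BondConfig V | ∀ x ∈ X, ¬ (openGraph ω).Reachable s x} ∩ openConn s y,
              F (openEdgeCluster ω s) ∂(prodBernoulli w)) *
            (prodBernoulli w).real ({ω : BondConfig V | ∀ x ∈ X, ¬ (openGraph ω).Reachable s x} ∩ openConn s y ∩ openConn s z) ≤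
          (prodBernoulli w).real ({ω : BondConfig V | ∀ x ∈ X, ¬ (openGraph ω).Reachable s x} ∩ openConn s y) *
            ∫ ω in {ω : BondConfig V | ∀ x ∈ X, ¬ (openGraph ω).Reachable s x} ∩ openConn s y ∩ openConn s z,
              F (openEdgeCluster ω s) ∂(prodBernoulli w)) :
    (prodBernoulli w).real ({ω : BondConfig V | ∀ x ∈ insert s X, ¬ (openGraph ω).Reachable y x} ∩
          {ω | ∀ x ∈ X, ¬ (openGraph ω).Reachable s x} ∩ openConn y z) *
        ((prodBernoulli w).real {ω : BondConfig V | ∀ x ∈ X, ¬ (openGraph ω).Reachable s x} *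
            (∫ ω in {ω : BondConfig V | ∀ x ∈ X, ¬ (openGraph ω).Reachable s x} ∩ openConn s y,
              F (openEdgeCluster ω s) ∂(prodBernoulli w)) -
          (∫ ω in {ω : BondConfig V | ∀ x ∈ X, ¬ (openGraph ω).Reachable s x},
              F (openEdgeCluster ω s) ∂(prodBernoulli w)) *
            (prodBernoulli w).real ({ω : BondConfig V | ∀ x ∈ X, ¬ (openGraph ω).Reachable s x} ∩ openConn s y)) ≤
      (prodBernoulli w).real ({ω : BondConfig V | ∀ x ∈ insert s X, ¬ (openGraph ω).Reachable y x} ∩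
          {ω | ∀ x ∈ X, ¬ (openGraph ω).Reachable s x}) *
        ((prodBernoulli w).real {ω : BondConfig V | ∀ x ∈ X, ¬ (openGraph ω).Reachable s x} *
            (∫ ω in {ω : BondConfig V | ∀ x ∈ X, ¬ (openGraph ω).Reachable s x} ∩ openConn s z,
              F (openEdgeCluster ω s) ∂(prodBernoulli w)) -
          (∫ ω in {ω : BondConfig V | ∀ x ∈ X, ¬ (openGraph ω).Reachable s x},
              F (openEdgeCluster ω s) ∂(prodBernoulli w)) *
            (prodBernoulli w).real ({ω : BondConfig V | ∀ x ∈ X, ¬ (openGraph ω).Reachable s x} ∩ openConn s z)) := by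
  classical
  set μ := prodBernoulli w with hμ
  have hmeas : ∀ S : Set (BondConfig V), MeasurableSet S := fun _ => MeasurableSet.of_discrete
  set D : Set (BondConfig V) := {ω | ∀ x ∈ X, ¬ (openGraph ω).Reachable s x} with hD
  set TW : Set (BondConfig V) := {ω : BondConfig V | ∀ x ∈ insert s X, ¬ (openGraph ω).Reachable y x} ∩ D ∩ openConn y z
    with hTW
  set T : Set (BondConfig V) := {ω : BondConfig V | ∀ x ∈ insert s X, ¬ (openGraph ω).Reachable y x} ∩ D with hT
  set Yv : Set (BondConfig V) := openConn s y with hYv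
  set Zv : Set (BondConfig V) := openConn s z with hZv
  set f : BondConfig V → ℝ := fun ω => F (openEdgeCluster ω s) with hf
  -- the case `s ∈ X`: `D = ∅` and both sides vanish
  by_cases hsX : s ∈ X
  · have hDe : D = ∅ := by
      refine eq_empty_of_forall_notMem fun ω hω => ?_
      exact hω s hsX (SimpleGraph.Reachable.refl s)
    have h0 : μ.real D = 0 := by rw [hDe]; exact measureReal_empty
    have h1 : ∀ S : Set (BondConfig V), μ.real (D ∩ S) = 0 := fun S => by rw [hDe, empty_inter]; exact measureReal_empty
    have h2 : ∫ ω in D, f ω ∂μ = 0 := by rw [hDe]; simp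
    change μ.real TW * (μ.real D * (∫ ω in D ∩ Yv, f ω ∂μ) - (∫ ω in D, f ω ∂μ) * μ.real (D ∩ Yv)) ≤
      μ.real T * (μ.real D * (∫ ω in D ∩ Zv, f ω ∂μ) - (∫ ω in D, f ω ∂μ) * μ.real (D ∩ Zv))
    rw [h0, h1, h1, h2]; simp
  -- masses and integrals
  set mY := μ.real (D ∩ Yv) with hmY
  set mN := μ.real (D ∩ Yvᶜ) with hmN
  set mYZ := μ.real (D ∩ Yv ∩ Zv) with hmYZ
  set mNZ := μ.real (D ∩ Yvᶜ ∩ Zv) with hmNZ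
  set IY := ∫ ω in D ∩ Yv, f ω ∂μ with hIY
  set IN := ∫ ω in D ∩ Yvᶜ, f ω ∂μ with hIN
  set IYZ := ∫ ω in D ∩ Yv ∩ Zv, f ω ∂μ with hIYZ
  set INZ := ∫ ω in D ∩ Yvᶜ ∩ Zv, f ω ∂μ with hINZ
  have hm : μ.real D = mY + mN := by
    have h := measureReal_inter_add_sdiff (μ := μ) (s := D) (hmeas Yv)
    rw [Set.sdiff_eq] at h; exact h.symm
  have hmZ : μ.real (D ∩ Zv) = mYZ + mNZ := by
    have h := measureReal_inter_add_sdiff (μ := μ) (s := D ∩ Zv) (hmeas Yv)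
    rw [Set.sdiff_eq, inter_right_comm D Zv Yv, inter_right_comm D Zv Yvᶜ] at h; exact h.symm
  have hI : ∫ ω in D, f ω ∂μ = IY + IN := (setIntegral_inter_add_compl w D Yv f).symm
  have hIZ : ∫ ω in D ∩ Zv, f ω ∂μ = IYZ + INZ := by
    have h := setIntegral_inter_add_compl w (D ∩ Zv) Yv f
    rw [inter_right_comm D Zv Yv, inter_right_comm D Zv Yvᶜ] at h; exact h.symm
  -- the three nonnegative terms of the split
  have hCN : IN * mNZ ≤ mN * INZ := by
    have h := markerPA_ge w s y z X F hF
    change mNZ * IN ≤ mN * INZ at h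
    linarith [mul_comm IN mNZ]
  have hSig : μ.real TW * mY * mN ≤ μ.real T * (μ.real D * mYZ - mY * μ.real (D ∩ Zv)) := by
    have h := mdlxJoint_connIndicator w s y z X
    change μ.real TW * mY * mN ≤ μ.real T * (μ.real D * mYZ - mY * μ.real (D ∩ Zv)) at h
    exact h
  have hFY : 0 ≤ μ.real D * IY - (∫ ω in D, f ω ∂μ) * mY := by
    have h := covD_conn_nonneg w s X hsX F hF y
    change 0 ≤ μ.real D * IY - (∫ ω in D, f ω ∂μ) * mY at h
    exact h
  change μ.real TW * (μ.real D * IY - (∫ ω in D, f ω ∂μ) * mY) ≤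
    μ.real T * (μ.real D * (∫ ω in D ∩ Zv, f ω ∂μ) - (∫ ω in D, f ω ∂μ) * μ.real (D ∩ Zv))
  rw [hmZ] at hSig
  rw [hm, hI, hIZ, hmZ] at *
  -- nonnegativity
  have hT0 : 0 ≤ μ.real T := measureReal_nonneg
  have hTW0 : 0 ≤ μ.real TW := measureReal_nonneg
  have hmY0 : 0 ≤ mY := measureReal_nonneg
  have hmN0 : 0 ≤ mN := measureReal_nonneg
  have hTle : μ.real T ≤ mN := measureReal_mono fun ω hω => ⟨hω.2, fun hY => hω.1 s (mem_insert s X) (hY : (openGraph ω).Reachable s y).symm⟩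
  have hTWle : μ.real TW ≤ μ.real T := measureReal_mono inter_subset_left
  -- the identity
  have ident := mdlx_totalCov_identity (μ.real T) (μ.real TW) mY mN mYZ mNZ IY IN IYZ INZ
  -- M · mY · mN ≥ 0
  have hMprod : 0 ≤ (μ.real T * ((mY + mN) * (IYZ + INZ) - (IY + IN) * (mYZ + mNZ)) -
      μ.real TW * ((mY + mN) * IY - (IY + IN) * mY)) * mY * mN := by
    rw [ident]
    have h1 : 0 ≤ mN * (mY * IYZ - IY * mYZ) := mul_nonneg hmN0 (by linarith [hC])
    have h2 : 0 ≤ mY * (mN * INZ - IN * mNZ) := mul_nonneg hmY0 (by linarith [hCN])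
    have h3 : 0 ≤ μ.real T * mN * mYZ - μ.real T * mY * mNZ - μ.real TW * mY * mN := by linarith [hSig]
    have h4 : 0 ≤ μ.real T * (mY + mN) := mul_nonneg hT0 (by linarith)
    have e := add_nonneg (mul_nonneg h4 (add_nonneg h1 h2)) (mul_nonneg h3 hFY)
    linarith [e]
  -- degenerate cases, then cancel `mY · mN > 0`
  by_cases hmNz : mN = 0
  · have hT' : μ.real T = 0 := le_antisymm (hmNz ▸ hTle) hT0
    have hTW' : μ.real TW = 0 := le_antisymm (hT' ▸ hTWle) hTW0
    rw [hT', hTW', zero_mul, zero_mul]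
  by_cases hmYz : mY = 0
  · -- `μ(D∩Y) = 0`: the `Y`-integrals vanish and the claim is `t · C_N ≥ 0`
    have hμY : μ (D ∩ Yv) = 0 := (measureReal_eq_zero_iff (measure_ne_top μ _)).1 hmYz
    have hIY0 : IY = 0 := setIntegral_measure_zero _ hμY
    have hμYZ : μ (D ∩ Yv ∩ Zv) = 0 := measure_mono_null inter_subset_left hμY
    have hIYZ0 : IYZ = 0 := setIntegral_measure_zero _ hμYZ
    have hmYZ0 : mYZ = 0 := by
      show μ.real (D ∩ Yv ∩ Zv) = 0
      rw [measureReal_def, hμYZ, ENNReal.toReal_zero]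
    rw [hmYz, hIY0, hIYZ0, hmYZ0]
    have : 0 ≤ μ.real T * (mN * INZ - IN * mNZ) := mul_nonneg hT0 (by linarith [hCN])
    have e2 : μ.real T * ((0 + mN) * (0 + INZ) - (0 + IN) * (0 + mNZ)) - μ.real TW * ((0 + mN) * 0 - (0 + IN) * 0) =
        μ.real T * (mN * INZ - IN * mNZ) := by ring
    linarith [this, e2]
  have hpos : 0 < mY * mN := mul_pos (lt_of_le_of_ne hmY0 (Ne.symm hmYz)) (lt_of_le_of_ne hmN0 (Ne.symm hmNz))
  have key : 0 ≤ μ.real T * ((mY + mN) * (IYZ + INZ) - (IY + IN) * (mYZ + mNZ)) -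
      μ.real TW * ((mY + mN) * IY - (IY + IN) * mY) := by
    by_contra hneg
    have hlt : μ.real T * ((mY + mN) * (IYZ + INZ) - (IY + IN) * (mYZ + mNZ)) -
        μ.real TW * ((mY + mN) * IY - (IY + IN) * mY) < 0 := lt_of_not_ge hneg
    have := mul_neg_of_neg_of_pos (mul_neg_of_neg_of_pos hlt (lt_of_le_of_ne hmY0 (Ne.symm hmYz)))
      (lt_of_le_of_ne hmN0 (Ne.symm hmNz))
    linarith
  linarith

end Consts

end Summit.CriticalPhenomena.PercolationContinuityZ3.Theorems

end
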